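import Summits.ValiantsHypothesis.ValiantsHypothesis.Theses.DetQP
import Summits.ValiantsHypothesis.ValiantsHypothesis.Theses.UlrichPadded
import Summits.ValiantsHypothesis.ValiantsHypothesis.Theorems.DetQPDetqpThesisStubIsVNPFamilyHyperdet
import Summits.ValiantsHypothesis.ValiantsHypothesis.Theorems.DetQPDetqpThesisStubIsPProjectionHyperdetPerPoly
import Summits.ValiantsHypothesis.ValiantsHypothesis.Theorems.DetQPDetqpThesisStubDetqpThesisOfIsPProjection
import Summits.ValiantsHypothesis.ValiantsHypothesis.Theorems.DetQPDetqpThesisStubDcPerPolyLeDcHyperdet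
import Summits.ValiantsHypothesis.ValiantsHypothesis.Theorems.DetqpThesis.Negative.IffPerNotVQP
import Summits.ValiantsHypothesis.ValiantsHypothesis.Theorems.DetqpThesis.Negative.Variants

/-!
# Crux `DetQP.DetqpThesis` (stmt-ValiantsHypothesis-0315), line `Sketch` (idea
# `four-dimensional-determinant`) — the transfer to Cayley's hyperdeterminant is an EQUIVALENCE

The line replaces the permanent by the generic four-dimensional (combinatorial, "first") Cayley
hyperdeterminant `HD_n := hyperdet (fun I : Fin 4 → Fin n => X I)`
(`Literature.Computability.AlgebraicComplexity.hyperdet`; Cayley 1843, Gelfand–Kapranov–Zelevinsky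
Ch. 14 §1; Gurvits 2004, Ex. 3.3 for `HD|diag = n! · per`).  This file assembles the four landed
stubs of the line into the two directions of the transfer and records the consequence for the
line's one remaining stub `stub_hyperdet_not_qp` (`X_HD := ¬ IsQPBounded (n ↦ dc(HD_n))`):

* `detqpThesis_of_hyperdet_not_qp` : `X_HD → DetqpThesis` (S2 `HD ∈ VNP` + S3 completeness
  transfer + S4 qp ∘ poly glue);
* `hyperdet_not_qp_of_detqpThesis` : `DetqpThesis → X_HD` (S6 `dc(per_n) ≤ dc(HD_n)`, `n ≥ 1`,
  and `dc(per_0) = dc(1) = 0`, `dcPer_zero` of Negative/Variants.lean);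
* `hyperdet_not_qp_iff_detqpThesis`, `hyperdet_not_qp_iff_target` (route UlrichPadded's name of
  the same item) and `hyperdet_not_qp_iff_extendedValiantHypothesis` : the remaining stub is
  LITERALLY equivalent to the crux, i.e. to the Extended Valiant Hypothesis `VNP ℂ ⊄ VQP ℂ`
  (`detqpThesis_iff_extendedValiantHypothesis`, Negative/IffPerNotVQP.lean).

So the line is a faithful REFORMULATION of the crux (what it changes is the symmetry of the hard
polynomial — connected stabiliser `SL_n⁴` instead of the permanent's torus-by-finite group — not
its logical strength); nothing weaker than `VNP ⊆ VQP` refutes the stub and nothing short of the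
Extended Valiant Hypothesis proves it.
-/

noncomputable section

-- single-conjunct layout: Sub = Summit, duplicated namespace component intended
set_option linter.dupNamespace false

namespace Summit.ValiantsHypothesis.ValiantsHypothesis.Theorems.DetQPDetqpThesis

open Literature.Computability.AlgebraicComplexity MvPolynomial

/-- **`X_HD → X`**: if the determinantal complexity of the generic four-dimensional
hyperdeterminant is not quasi-polynomially bounded, then neither is that of the permanent
(`HD ∈ VNP`, Valiant completeness of `per` over `ℂ`, qp ∘ poly = qp). -/
theorem detqpThesis_of_hyperdet_not_qp
    (h : ¬ IsQPBounded (fun n => determinantalComplexity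
      (hyperdet (fun I : Fin 4 → Fin n => (X I : MvPolynomial (Fin 4 → Fin n) ℂ))))) :
    Summit.ValiantsHypothesis.ValiantsHypothesis.Theses.DetQP.DetqpThesis :=
  stub_detqpThesis_of_isPProjection (fun n => Fin 4 → Fin n)
    (fun n => hyperdet (fun I : Fin 4 → Fin n => (X I : MvPolynomial (Fin 4 → Fin n) ℂ)))
    (stub_isPProjection_hyperdet_perPoly stub_isVNPFamily_hyperdet) h

/-- **`X → X_HD`**: a quasi-polynomial bound for `dc(HD_n)` would bound `dc(per_n)` by the same
template (`dc(per_n) ≤ dc(HD_n)` for `n ≥ 1`, and `dc(per_0) = 0`, the landed `dcPer_zero` of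
Negative/Variants.lean). -/
theorem hyperdet_not_qp_of_detqpThesis
    (hX : Summit.ValiantsHypothesis.ValiantsHypothesis.Theses.DetQP.DetqpThesis) :
    ¬ IsQPBounded (fun n => determinantalComplexity
      (hyperdet (fun I : Fin 4 → Fin n => (X I : MvPolynomial (Fin 4 → Fin n) ℂ)))) := by
  rintro ⟨c, hc⟩
  refine hX ⟨c, fun n => ?_⟩
  rcases Nat.eq_zero_or_pos n with rfl | hn
  · simp [Summit.ValiantsHypothesis.Theorems.DetqpThesis.Negative.dcPer_zero]
  · exact (stub_dc_perPoly_le_dc_hyperdet n hn).trans (hc n)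

/-- **The line's remaining stub is exactly the crux**: `X_HD ↔ DetqpThesis`. -/
theorem hyperdet_not_qp_iff_detqpThesis :
    (¬ IsQPBounded (fun n => determinantalComplexity
      (hyperdet (fun I : Fin 4 → Fin n => (X I : MvPolynomial (Fin 4 → Fin n) ℂ))))) ↔
    Summit.ValiantsHypothesis.ValiantsHypothesis.Theses.DetQP.DetqpThesis :=
  ⟨detqpThesis_of_hyperdet_not_qp, hyperdet_not_qp_of_detqpThesis⟩

/-- The same equivalence under route UlrichPadded's name `Target` of the shared item (the same
term as `DetQP.DetqpThesis`). -/
theorem hyperdet_not_qp_iff_target :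
    (¬ IsQPBounded (fun n => determinantalComplexity
      (hyperdet (fun I : Fin 4 → Fin n => (X I : MvPolynomial (Fin 4 → Fin n) ℂ))))) ↔
    Summit.ValiantsHypothesis.ValiantsHypothesis.Theses.UlrichPadded.Target :=
  hyperdet_not_qp_iff_detqpThesis

/-- **`X_HD` is the Extended Valiant Hypothesis over `ℂ`** (`VNP ℂ ⊄ VQP ℂ`, BCS97 (21.32)):
composition with `detqpThesis_iff_extendedValiantHypothesis` (Negative/IffPerNotVQP.lean).  A
refutation of the stub is `VNP ⊆ VQP` over `ℂ`, nothing weaker; a proof of it is EVH. -/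
theorem hyperdet_not_qp_iff_extendedValiantHypothesis :
    (¬ IsQPBounded (fun n => determinantalComplexity
      (hyperdet (fun I : Fin 4 → Fin n => (X I : MvPolynomial (Fin 4 → Fin n) ℂ))))) ↔
    ExtendedValiantHypothesis ℂ :=
  hyperdet_not_qp_iff_detqpThesis.trans
    Summit.ValiantsHypothesis.Theorems.DetqpThesis.Negative.detqpThesis_iff_extendedValiantHypothesis

end Summit.ValiantsHypothesis.ValiantsHypothesis.Theorems.DetQPDetqpThesis

end
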